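import Summits.Ventures.CertifiedManyBodySolver.Downfold.EmeryClusterCapSeam
import HarnessLib

/-!
# AFFINE BANDS from vertex floors: a concave energy minus an affine cap attains its box minimum at a vertex —
# the door that turns 2⁵ vertex certificates + ONE Rayleigh plane into a FUNCTION-VALUED two-sided box word

Venture CertifiedManyBodySolver, crew hubbard-fast S2 (iv) «three-band Emery boxes», seat hubbard-box-p2 (g16; device «KLDL-V» = all-vertex
floors ⇒ function-valued box words); namespace `Summit.Ventures.CertifiedManyBodySolver.Downfold` (sequel of `S2SeamEmery` door 2 and
`EmeryClusterCapSeam`). Everything here is PROVED (Mathlib + the two seams); no number about a material.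

WHY. A Rayleigh vector gives a cap `e(θ, ρ) ≤ Σ_a θ_a T_a` valid at EVERY coupling vector `θ` (an affine — indeed linear — function of `θ`);
along the physical line `θ = emeryLine s q` it reads `e ≤ A(q) := Σ_k q_k · lineCoeff s T k` (`sum_emeryLine_mul_eq`). The energy is jointly
CONCAVE in `q` (`concaveOn_emeryEnergyDensity_line`), hence so is `e − A`; a concave function on a coordinate box is bounded below by its
vertex minimum (`le_of_concaveOn_of_forall_boxVertices`). So if floor certificates at the `2^|κ|` vertices `v` give `A(v) − w ≤ e(v)`, then
`A(q) − w ≤ e(q) ≤ A(q)` on the WHOLE box: a two-sided word whose both sides MOVE with the parameters, of constant width `w` = the worst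
vertex slack — instead of the constant pair `[min floor, max cap]`, whose width on a wide box is mostly the range of `e` itself
(hubbard-box-p3 g20, pub/hubbard-fast INBOX 2026-08-28T15:45Z: ≥ 39 % of the La₂CuO₄ #18 window v2 is range-of-e).

* §1 generic: `affine_sub_le_of_concaveOn_of_forall_boxVertices` (any finite index type, any concave `f`, affine `c + Σ g_k x_k`).
* §2 the line: `affineLine_sub_le_emeryEnergyDensity_line` (floor side), `emeryEnergyDensity_line_mem_affineBand` (both sides from one
  plane `T` + vertex slacks), `holdsOn_emeryEnergyAffineBand` (typed Emery box through `holdsOn_of_forall_emeryLineBox`).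
* §3 bookkeeping for six-boxes: `forall_mem_piFinset_fin6` — a property checked at the 64 named corners `![a,b,c,d,e,f]`,
  `a ∈ {lo 0, hi 0}`, …, holds at every element of `Fintype.piFinset (fun k => {lo k, hi k})` (the vertex set of the seams).

HONEST FRAMING: a door; energy words of the decorated model only; not a superconductivity verdict; no number of record moves.
-/

noncomputable section

namespace Summit.Ventures.CertifiedManyBodySolver.Downfold

open Finset Literature.MathematicalPhysics.QuantumLattice
open scoped BigOperators

/-! ## §1 Generic: concave minus affine is bounded below by its vertex minimum -/

section Generic

variable {κ : Type*} [Fintype κ]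

/-- **An affine function `c + Σ_k g_k x_k` is convex** (on all of `κ → ℝ`). [cite: Rockafellar1970, Thm 4.1] -/
theorem convexOn_affineForm (c : ℝ) (g : κ → ℝ) : ConvexOn ℝ Set.univ fun x : κ → ℝ => c + ∑ k, g k * x k := by
  have hL : ConvexOn ℝ Set.univ (fun x : κ → ℝ => (∑ k, g k • (LinearMap.proj k : (κ → ℝ) →ₗ[ℝ] ℝ)) x) :=
    (∑ k, g k • (LinearMap.proj k : (κ → ℝ) →ₗ[ℝ] ℝ)).convexOn convex_univ
  have h := (convexOn_const c convex_univ).add hL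
  refine h.congr fun x _ => ?_
  simp only [Pi.add_apply, LinearMap.coe_sum, Finset.sum_apply, LinearMap.smul_apply, LinearMap.coe_proj, Function.eval, smul_eq_mul]

/-- **Concave minus affine is concave.** [cite: Rockafellar1970, Thm 5.2] -/
theorem concaveOn_sub_affineForm {f : (κ → ℝ) → ℝ} (hf : ConcaveOn ℝ Set.univ f) (c : ℝ) (g : κ → ℝ) :
    ConcaveOn ℝ Set.univ fun x : κ → ℝ => f x - (c + ∑ k, g k * x k) :=
  hf.sub (convexOn_affineForm c g)

/-- **AFFINE BAND RULE (floor side).** If `f` is concave and at each of the `2^|κ|` vertices `v` of the box `Set.Icc lo hi` the affine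
function `c + Σ_k g_k v_k` exceeds `f v` by at most `w`, then `c + Σ_k g_k x_k − w ≤ f x` at EVERY point of the box.
[cite: Rockafellar1970, Thm 32.2] -/
theorem affine_sub_le_of_concaveOn_of_forall_boxVertices [DecidableEq κ] {f : (κ → ℝ) → ℝ} (hf : ConcaveOn ℝ Set.univ f)
    (c : ℝ) (g : κ → ℝ)
    (lo hi : κ → ℝ) {w : ℝ}
    (hw : ∀ v ∈ Fintype.piFinset (fun k => ({lo k, hi k} : Finset ℝ)), c + ∑ k, g k * v k - w ≤ f v)
    {x : κ → ℝ} (hx : x ∈ Set.Icc lo hi) : c + ∑ k, g k * x k - w ≤ f x := by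
  have h := le_of_concaveOn_of_forall_boxVertices (concaveOn_sub_affineForm hf c g) lo hi (m := -w)
    (fun v hv => by linarith [hw v hv]) hx
  linarith

end Generic

/-! ## §2 The decorated three-band model along the physical line -/

/-- **Floor side on the line**: vertex slacks `Σ_k v_k g_k − w ≤ e(emeryLine s v, ρ)` at the `2⁶` (or fewer, when `lo k = hi k`) vertices of a
six-box give `Σ_k q_k g_k − w ≤ e(emeryLine s q, ρ)` on the whole box. [cite: Israel1979, Thm. I.3.4] [cite: Rockafellar1970, Thm 32.2] -/
theorem affineLine_sub_le_emeryEnergyDensity_line (s : Fin 4 → ℝ) (ρ : ℝ) (lo hi : Fin 6 → ℝ) (g : Fin 6 → ℝ) {w : ℝ}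
    (hw : ∀ v ∈ Fintype.piFinset (fun k => ({lo k, hi k} : Finset ℝ)), ∑ k, v k * g k - w ≤ emeryEnergyDensity (emeryLine s v) ρ)
    {q : Fin 6 → ℝ} (hq : q ∈ Set.Icc lo hi) : ∑ k, q k * g k - w ≤ emeryEnergyDensity (emeryLine s q) ρ := by
  have h := affine_sub_le_of_concaveOn_of_forall_boxVertices (concaveOn_emeryEnergyDensity_line s ρ) 0 g lo hi (w := w)
    (fun v hv => by
      have h' := hw v hv
      rw [zero_add, show ∑ k, g k * v k = ∑ k, v k * g k from Finset.sum_congr rfl fun _ _ => mul_comm _ _]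
      exact h') hq
  rw [zero_add, show ∑ k, g k * q k = ∑ k, q k * g k from Finset.sum_congr rfl fun _ _ => mul_comm _ _] at h
  exact h

/-- **THE AFFINE BAND from one Rayleigh plane.** An affine cap `e(θ, ρ) ≤ Σ_a θ_a T_a` valid at every `θ` and vertex slacks
`Σ_k v_k · lineCoeff s T k − w ≤ e(emeryLine s v, ρ)` at the vertices of `Set.Icc lo hi` give, at EVERY `q` of the box,
`A(q) − w ≤ e(emeryLine s q, ρ) ≤ A(q)` with `A(q) = Σ_k q_k · lineCoeff s T k`. [cite: Ruelle1969, §3.3] [cite: Rockafellar1970, Thm 32.2] -/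
theorem emeryEnergyDensity_line_mem_affineBand (s : Fin 4 → ℝ) {ρ : ℝ} {T : Fin 14 → ℝ}
    (hcap : ∀ θ : Fin 14 → ℝ, emeryEnergyDensity θ ρ ≤ ∑ a, θ a * T a) (lo hi : Fin 6 → ℝ) {w : ℝ}
    (hw : ∀ v ∈ Fintype.piFinset (fun k => ({lo k, hi k} : Finset ℝ)),
      ∑ k, v k * lineCoeff s T k - w ≤ emeryEnergyDensity (emeryLine s v) ρ)
    {q : Fin 6 → ℝ} (hq : q ∈ Set.Icc lo hi) :
    ∑ k, q k * lineCoeff s T k - w ≤ emeryEnergyDensity (emeryLine s q) ρ ∧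
      emeryEnergyDensity (emeryLine s q) ρ ≤ ∑ k, q k * lineCoeff s T k := by
  refine ⟨affineLine_sub_le_emeryEnergyDensity_line s ρ lo hi (lineCoeff s T) hw hq, ?_⟩
  rw [← sum_emeryLine_mul_eq]
  exact hcap _

/-- **THE AFFINE-BAND DOOR on a typed Emery box** (entries `t_pd, t_pp, Delta_pd, U_dd, U_pp`, reference level `εp`): one global affine cap
plus vertex slacks `≤ w` give the box word `p ↦ A(q(p)) − w ≤ e ≤ A(q(p))`, `q(p) = emeryLineCoords εp p`, `A(q) = Σ_k q_k · lineCoeff s T k`.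
[cite: Ruelle1969, §3.3] [cite: Rockafellar1970, Thm 32.2] -/
theorem holdsOn_emeryEnergyAffineBand {E : EmeryBox} {eA eB eD eUd eUp : Entry} {εp : ℚ}
    (hA : E .tpd = some eA) (hB : E .tpp = some eB) (hD : E .DeltaPd = some eD)
    (hUd : E .Udd = some eUd) (hUp : E .Upp = some eUp) (s : Fin 4 → ℝ) {ρ : ℝ} {T : Fin 14 → ℝ}
    (hcap : ∀ θ : Fin 14 → ℝ, emeryEnergyDensity θ ρ ≤ ∑ a, θ a * T a) {w : ℝ}
    (hw : ∀ v ∈ Fintype.piFinset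
        (fun k => ({emeryLo εp eA eB eD eUd eUp k, emeryHi εp eA eB eD eUd eUp k} : Finset ℝ)),
      ∑ k, v k * lineCoeff s T k - w ≤ emeryEnergyDensity (emeryLine s v) ρ) :
    HoldsOn (fun p : EmeryCoord → ℝ =>
      ∑ k, emeryLineCoords (εp : ℝ) p k * lineCoeff s T k - w ≤ emeryEnergyDensity (emeryLine s (emeryLineCoords (εp : ℝ) p)) ρ ∧
        emeryEnergyDensity (emeryLine s (emeryLineCoords (εp : ℝ) p)) ρ ≤ ∑ k, emeryLineCoords (εp : ℝ) p k * lineCoeff s T k) E :=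
  holdsOn_of_forall_emeryLineBox hA hB hD hUd hUp (fun _ hq => emeryEnergyDensity_line_mem_affineBand s hcap _ _ hw hq)

/-! ## §3 Bookkeeping: the vertices of a six-box by name -/

/-- **The 64 named corners exhaust the vertex set of a six-box.** If `P ![a, b, c, d, e, f]` holds for every choice
`a ∈ {lo 0, hi 0}`, `b ∈ {lo 1, hi 1}`, …, `f ∈ {lo 5, hi 5}`, then `P v` for every `v ∈ Fintype.piFinset (fun k => {lo k, hi k})`.
[folklore] -/
theorem forall_mem_piFinset_fin6 {lo hi : Fin 6 → ℝ} {P : (Fin 6 → ℝ) → Prop}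
    (h : ∀ a ∈ ({lo 0, hi 0} : Finset ℝ), ∀ b ∈ ({lo 1, hi 1} : Finset ℝ), ∀ c ∈ ({lo 2, hi 2} : Finset ℝ),
      ∀ d ∈ ({lo 3, hi 3} : Finset ℝ), ∀ e ∈ ({lo 4, hi 4} : Finset ℝ), ∀ f ∈ ({lo 5, hi 5} : Finset ℝ), P ![a, b, c, d, e, f]) :
    ∀ v ∈ Fintype.piFinset (fun k => ({lo k, hi k} : Finset ℝ)), P v := by
  intro v hv
  rw [Fintype.mem_piFinset] at hv
  have hv' : v = ![v 0, v 1, v 2, v 3, v 4, v 5] := by ext k; fin_cases k <;> rfl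
  rw [hv']
  exact h _ (hv 0) _ (hv 1) _ (hv 2) _ (hv 3) _ (hv 4) _ (hv 5)

/-- **Named-corner form of the affine band on the line**: the 64 corner slacks by name ⇒ the band on the box. [cite: Rockafellar1970, Thm 32.2] -/
theorem emeryEnergyDensity_line_mem_affineBand_of_corners (s : Fin 4 → ℝ) {ρ : ℝ} {T : Fin 14 → ℝ}
    (hcap : ∀ θ : Fin 14 → ℝ, emeryEnergyDensity θ ρ ≤ ∑ a, θ a * T a) (lo hi : Fin 6 → ℝ) {w : ℝ}
    (hw : ∀ a ∈ ({lo 0, hi 0} : Finset ℝ), ∀ b ∈ ({lo 1, hi 1} : Finset ℝ), ∀ c ∈ ({lo 2, hi 2} : Finset ℝ),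
      ∀ d ∈ ({lo 3, hi 3} : Finset ℝ), ∀ e ∈ ({lo 4, hi 4} : Finset ℝ), ∀ f ∈ ({lo 5, hi 5} : Finset ℝ),
      ∑ k, (![a, b, c, d, e, f] : Fin 6 → ℝ) k * lineCoeff s T k - w ≤ emeryEnergyDensity (emeryLine s ![a, b, c, d, e, f]) ρ)
    {q : Fin 6 → ℝ} (hq : q ∈ Set.Icc lo hi) :
    ∑ k, q k * lineCoeff s T k - w ≤ emeryEnergyDensity (emeryLine s q) ρ ∧
      emeryEnergyDensity (emeryLine s q) ρ ≤ ∑ k, q k * lineCoeff s T k :=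
  emeryEnergyDensity_line_mem_affineBand s hcap lo hi
    (forall_mem_piFinset_fin6 (P := fun v => ∑ k, v k * lineCoeff s T k - w ≤ emeryEnergyDensity (emeryLine s v) ρ) hw) hq

end Summit.Ventures.CertifiedManyBodySolver.Downfold

end
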